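import Literature.NumberTheory.LFunctions.WeilTwoPrimeOddMarginHBase
import Literature.NumberTheory.LFunctions.WeilTwoPrimeOddMarginHDataP22
import Literature.NumberTheory.LFunctions.WeilBlockRowsP
import HarnessLib

/-!
# Two-prime odd-margin certificate H: the materialized block agrees with `P_r`, rows 40–49

`WeilCert.checkPmRow` (row `k` of the claim `Pm_{kl} = P_r(2k+1, 2l+1)`) for certificate H, by `decide +kernel`. Pure proof file; nothing is asserted.
-/

noncomputable section

namespace Literature.NumberTheory.LFunctions

set_option maxHeartbeats 0 in
/-- Row 40 of the materialized block is row 40 of `P_r` (certificate H). [folklore] -/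
theorem checkPmRow1_40_weilCert23H : weilCert23HBase.checkPmRow weilCert23HNu weilCert23HPm 1 40 = true := by
  decide +kernel

set_option maxHeartbeats 0 in
/-- Row 41 of the materialized block is row 41 of `P_r` (certificate H). [folklore] -/
theorem checkPmRow1_41_weilCert23H : weilCert23HBase.checkPmRow weilCert23HNu weilCert23HPm 1 41 = true := by
  decide +kernel

set_option maxHeartbeats 0 in
/-- Row 42 of the materialized block is row 42 of `P_r` (certificate H). [folklore] -/
theorem checkPmRow1_42_weilCert23H : weilCert23HBase.checkPmRow weilCert23HNu weilCert23HPm 1 42 = true := by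
  decide +kernel

set_option maxHeartbeats 0 in
/-- Row 43 of the materialized block is row 43 of `P_r` (certificate H). [folklore] -/
theorem checkPmRow1_43_weilCert23H : weilCert23HBase.checkPmRow weilCert23HNu weilCert23HPm 1 43 = true := by
  decide +kernel

set_option maxHeartbeats 0 in
/-- Row 44 of the materialized block is row 44 of `P_r` (certificate H). [folklore] -/
theorem checkPmRow1_44_weilCert23H : weilCert23HBase.checkPmRow weilCert23HNu weilCert23HPm 1 44 = true := by
  decide +kernel

set_option maxHeartbeats 0 in
/-- Row 45 of the materialized block is row 45 of `P_r` (certificate H). [folklore] -/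
theorem checkPmRow1_45_weilCert23H : weilCert23HBase.checkPmRow weilCert23HNu weilCert23HPm 1 45 = true := by
  decide +kernel

set_option maxHeartbeats 0 in
/-- Row 46 of the materialized block is row 46 of `P_r` (certificate H). [folklore] -/
theorem checkPmRow1_46_weilCert23H : weilCert23HBase.checkPmRow weilCert23HNu weilCert23HPm 1 46 = true := by
  decide +kernel

set_option maxHeartbeats 0 in
/-- Row 47 of the materialized block is row 47 of `P_r` (certificate H). [folklore] -/
theorem checkPmRow1_47_weilCert23H : weilCert23HBase.checkPmRow weilCert23HNu weilCert23HPm 1 47 = true := by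
  decide +kernel

set_option maxHeartbeats 0 in
/-- Row 48 of the materialized block is row 48 of `P_r` (certificate H). [folklore] -/
theorem checkPmRow1_48_weilCert23H : weilCert23HBase.checkPmRow weilCert23HNu weilCert23HPm 1 48 = true := by
  decide +kernel

set_option maxHeartbeats 0 in
/-- Row 49 of the materialized block is row 49 of `P_r` (certificate H). [folklore] -/
theorem checkPmRow1_49_weilCert23H : weilCert23HBase.checkPmRow weilCert23HNu weilCert23HPm 1 49 = true := by
  decide +kernel


end Literature.NumberTheory.LFunctions
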